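import Summits.BirchSwinnertonDyer.BirchSwinnertonDyer.Theorems.UniversalToricDescentRationalSplitIMCInclusionAtThreeClosedModuloV83Jacquet
import Summits.BirchSwinnertonDyer.BirchSwinnertonDyer.Theorems.UniversalToricDescentThinCombFibredSupply
import Literature.NumberTheory.EllipticCurves.RankinSelbergHeckeContinuation
import HarnessLib

/-!
# The rational wall `RationalSplitIMCInclusionAtThree` (stmt-BirchSwinnertonDyer-24207) CLOSED MODULO {(N) normalised ♯♯-frame, Jacquet's
# cone fact BY NAME, Nekovář's fact, K2-rat}: the fibred supply (S) is DISCHARGED (certificate `V84`, `--supports stmt-BirchSwinnertonDyer-24207`;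
# cell `pub/bsd-wall`, LEAD `cruxlead-24207` g33)

WHY THIS FILE. The v8.3 certificates `…ClosedModuloV83Jacquet` (p767554) / `…V83Print` (p767823) derive the registered first stub of the line
`ratwall_thin_comb` (`stub_toricExistsSymmUpTo2`, v8.2 VERBATIM) from THREE displayed inputs: (N) a normalised ♯♯-frame (`Y = X·ι′⁻¹(N·|d_K|/4)`;
Hida 1988 Thm. 5.1b at `p = 3`, an adaptation — the research content), `hJ` = Jacquet 1972 Thm. 19.14 / Cor. 19.15 on the cone (print fact
`jacquet1972_functionalEquation_rankinSelbergHecke_cone`), and `hS` = the FIBRED SUPPLY of interpolation characters through the pair in a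
`𝔭`-adapted frame («print S-a/S-b + kernel-todo S-d»). This gen made `hS` a THEOREM: `…ThinComb.FibredSupply.fibredSupply` (S-a =
`HeckeCharacter.exists_hasInfinityType_pos_zero_unramified`, any class number; S-b/S-d = `…ThinComb.VerticalCharacter`; S-c = the same Jacquet fact).
Hence:

* `toricExistsSymmUpTo2_of_normalised_of_jacquet hN hJ` : the registered `stub_toricExistsSymmUpTo2` (v8.2 signature VERBATIM) from (N) and the
  Jacquet cone fact ALONE;
* `RationalSplitIMCInclusionAtThree_of_normalisedToric_of_jacquet_of_nekovar_of_ratCombDvd` : the crux BY NAME from (N) + Jacquet + Nekovář's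
  print fact (stub 2, `nekovar2006_xGr₂_isTorsion_iff_and_charIdeal_eq_map_inv`) + `stub_ratCombDvdUpTo2` (stub 3, OPEN research: Gu 2025 Conj. 2.15).

So the v8.3 residue of the crux reads: (N) [adaptation of Hida 1988 at the additive split 3] ⊕ PRINT {Jacquet 1972 (typed), Nekovář 2006 (typed)}
⊕ RESEARCH {K2-rat}. v8.3 is NOT registered (v8.2 stays the line of record; this is a composition check for the planner). HONEST SCOPE: none of the
three inputs is proved here; nothing here is evidence that a normalised toric frame exists at the additive split `3`; BSD is proved for no curve;
24207 / 20395 / 20186 OPEN.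

References: [cite: Jacquet1972, §19 Thm. 19.14, Cor. 19.15] [cite: Tate1979, (3.1), (3.2.3), (3.4)] [cite: Hida1988AIF, §5 Thm. 5.1b]
[cite: BuyukbodukLei2017, §2.4 Thm. 2.18, Def. 3.8 (arXiv:1707.00557)] [cite: CastellaWan2023, §2.4 Thm. 2.11 (arXiv:1607.02019)]
[cite: Nekovar2006, Thm. 8.9.9, Prop. 9.6.6 (ii)] [cite: Gu2025FiniteSlopeUniversalRS, Conj. 2.15 (arXiv:2512.01184)] [cite: Weil1956, §1–§2]
-/

set_option linter.dupNamespace false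
set_option autoImplicit false

noncomputable section

open scoped Classical MatrixGroups

namespace Summit.BirchSwinnertonDyer.BirchSwinnertonDyer.Theorems.UniversalToricDescentRatwallThinCombLine.V84

open NumberField IsDedekindDomain Field
open Literature.NumberTheory.EllipticCurves Literature.NumberTheory.GaloisRepresentations
open Literature.NumberTheory.EllipticCurves.ModularForms
open Summit.BirchSwinnertonDyer.BirchSwinnertonDyer.Theorems.UniversalToricDescentThinComb

/-- **Stub 1 of the line (v8.2 signature VERBATIM) from the normalised frame (N) and Jacquet's functional equation on the cone BY NAME** —
the fibred supply is now the tree theorem `…ThinComb.FibredSupply.fibredSupply`. Proof = the proof of `…V83Jacquet.toricExistsSymmUpTo2_of_normalised_of_jacquetCone`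
with `hS` replaced by the theorem (in the stub's frame: Heegner hypothesis, `ι′` inducing `𝔭`, `κ₁` unramified outside `𝔭`, the lift `τ`).
[cite: Jacquet1972, §19 Thm. 19.14, Cor. 19.15] [cite: Hida1988AIF, §5 Thm. 5.1b] [cite: BuyukbodukLei2017, Def. 3.8 (arXiv:1707.00557)] [cite: Weil1956, §1–§2] -/
theorem toricExistsSymmUpTo2_of_normalised_of_jacquet
    (hN :
        ∀ (W : WeierstrassCurve ℚ) [W.IsElliptic] [W.IsGloballyMinimal] (N : ℕ) [NeZero N] (K : Type) [Field K]
          [NumberField K] (Dt : Literature.NumberTheory.EllipticCurves.ModularForms.ModularParametrizationData W N),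
        Summit.BirchSwinnertonDyer.Rank1Residual.Additive.ClassO6 W 3 → W.HasSurjectiveModNGaloisRep 3 →
        W.analyticRank = 1 → W.conductorNorm ℤ = N → IsImaginaryQuadratic K → SatisfiesHeegnerHypothesis N K →
        ∀ (κ' : ZpExtension K 3), κ'.IsAnticyclotomic → ∀ (γ : Field.absoluteGaloisGroup K) [Fact (κ'.IsTopGenerator γ)]
          (𝔭 : HeightOneSpectrum (𝓞 K)), ((3 : ℕ) : 𝓞 K) ∈ 𝔭.asIdeal →
          𝔭.asIdeal.ramificationIdx (𝓞 ℚ) = 1 → 𝔭.asIdeal.inertiaDeg (𝓞 ℚ) = 1 →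
        ∀ (𝔭' : HeightOneSpectrum (𝓞 K)), ((3 : ℕ) : 𝓞 K) ∈ 𝔭'.asIdeal → 𝔭' ≠ 𝔭 →
        ∀ (ι' : PadicAlgCl 3 ≃+* ℂ), Summit.BirchSwinnertonDyer.BirchSwinnertonDyer.Theorems.SchneiderFree.BranchInducesPrime 3 ι' 𝔭 →
        ∀ (κ₁ κ₂ : ZpExtension K 3) (γ₁ γ₂ : Field.absoluteGaloisGroup K) (k : ℕ)
          [Fact (ZpExtension.IsTopGeneratorPair κ₁ κ₂ γ₁ γ₂)],
        (∀ v : HeightOneSpectrum (𝓞 K), v ≠ 𝔭 → ∀ 𝔓 ∈ v.primesAbove,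
            𝔓.inertia (Field.absoluteGaloisGroup K) ≤ κ₁.kerSubgroup) →
        ZpExtension.pairKer κ₁ κ₂ ≤ κ'.kerSubgroup → γ₁ * γ⁻¹ ∈ κ'.kerSubgroup → γ₂ * (γ ^ (3 ^ k))⁻¹ ∈ κ'.kerSubgroup →
        ∃ (ΩK' : ℂ) (C X : ℂ_[3]) (L₂ : PowerSeries (PowerSeries (unrIntegers 3))),
          ΩK' ≠ 0 ∧ C ≠ 0 ∧ X ≠ 0 ∧
          IsToricTwoVarLFunctionUpTo₂ C X
            (X * (((ι'.symm ((N : ℂ) * ((NumberField.discr K).natAbs : ℂ) / 4) : PadicAlgCl 3)) : ℂ_[3]))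
            ι' 𝔭 𝔭' κ₁ κ₂ γ₁ γ₂ Dt.f ΩK' L₂)
    (hJ : Literature.NumberTheory.EllipticCurves.jacquet1972_functionalEquation_rankinSelbergHecke_cone) :
    ∀ (W : WeierstrassCurve ℚ) [W.IsElliptic] [W.IsGloballyMinimal] (N : ℕ) [NeZero N] (K : Type) [Field K]
      [NumberField K] (Dt : Literature.NumberTheory.EllipticCurves.ModularForms.ModularParametrizationData W N),
    Summit.BirchSwinnertonDyer.Rank1Residual.Additive.ClassO6 W 3 → W.HasSurjectiveModNGaloisRep 3 →
    W.analyticRank = 1 → W.conductorNorm ℤ = N → IsImaginaryQuadratic K → SatisfiesHeegnerHypothesis N K →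
    ∀ (κ' : ZpExtension K 3), κ'.IsAnticyclotomic → ∀ (γ : Field.absoluteGaloisGroup K) [Fact (κ'.IsTopGenerator γ)]
      (𝔭 : HeightOneSpectrum (𝓞 K)), ((3 : ℕ) : 𝓞 K) ∈ 𝔭.asIdeal →
      𝔭.asIdeal.ramificationIdx (𝓞 ℚ) = 1 → 𝔭.asIdeal.inertiaDeg (𝓞 ℚ) = 1 →
    ∀ (𝔭' : HeightOneSpectrum (𝓞 K)), ((3 : ℕ) : 𝓞 K) ∈ 𝔭'.asIdeal → 𝔭' ≠ 𝔭 →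
    ∀ (ι' : PadicAlgCl 3 ≃+* ℂ), Summit.BirchSwinnertonDyer.BirchSwinnertonDyer.Theorems.SchneiderFree.BranchInducesPrime 3 ι' 𝔭 →
    ∀ (κ₁ κ₂ : ZpExtension K 3) (γ₁ γ₂ : Field.absoluteGaloisGroup K) (k : ℕ)
      [Fact (ZpExtension.IsTopGeneratorPair κ₁ κ₂ γ₁ γ₂)],
    (∀ v : HeightOneSpectrum (𝓞 K), v ≠ 𝔭 → ∀ 𝔓 ∈ v.primesAbove,
        𝔓.inertia (Field.absoluteGaloisGroup K) ≤ κ₁.kerSubgroup) →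
    ZpExtension.pairKer κ₁ κ₂ ≤ κ'.kerSubgroup → γ₁ * γ⁻¹ ∈ κ'.kerSubgroup → γ₂ * (γ ^ (3 ^ k))⁻¹ ∈ κ'.kerSubgroup →
    ∃ (ΩK' : ℂ) (C X Y : ℂ_[3]) (L₂ : PowerSeries (PowerSeries (unrIntegers 3))),
      ΩK' ≠ 0 ∧ C ≠ 0 ∧ X ≠ 0 ∧ Y ≠ 0 ∧
      IsToricTwoVarLFunctionUpTo₂ C X Y ι' 𝔭 𝔭' κ₁ κ₂ γ₁ γ₂ Dt.f ΩK' L₂ ∧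
      ∀ (c : Field.absoluteGaloisGroup ℚ), c ∉ Set.range (absGaloisRestrict ℚ K) →
      ∀ (τ : Field.absoluteGaloisGroup K → Field.absoluteGaloisGroup K),
        (∀ σ, absGaloisRestrict ℚ K (τ σ) = c * (absGaloisRestrict ℚ K σ)⁻¹ * c⁻¹) →
      ∀ (A : GL (Fin 2) ℤ_[3]), (A : Matrix (Fin 2) (Fin 2) ℤ_[3]) = IwasawaAlgebra₂.frameMatrixOf κ₁ κ₂ γ₁ γ₂ τ →
        letI : Algebra ℤ_[3] (unrIntegers 3) := (Summit.BirchSwinnertonDyer.Rank1Residual.X11b.Halves.toUnr 3).toAlgebra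
        Associated (IwasawaAlgebra₂.frameSubst (unrIntegers 3) A L₂) L₂ := by
  intro W _ _ N _ K _ _ Dt hO6 hsurj hrk hN' hK hH κ' hκ' γ hγ 𝔭 h3 hram hdeg 𝔭' h3' hne ι' hι κ₁ κ₂ γ₁ γ₂ k hpair hur₁ hker hγ₁ hγ₂
  obtain ⟨ΩK', C, X, L₂, hΩK', hC, hX, hL₂⟩ :=
    hN W N K Dt hO6 hsurj hrk hN' hK hH κ' hκ' γ 𝔭 h3 hram hdeg 𝔭' h3' hne ι' hι κ₁ κ₂ γ₁ γ₂ k hur₁ hker hγ₁ hγ₂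
  set κc : ℂ := (N : ℂ) * ((NumberField.discr K).natAbs : ℂ) / 4 with hκc
  have hκc0 : κc ≠ 0 := by
    refine div_ne_zero (mul_ne_zero (by exact_mod_cast NeZero.ne N) ?_) (by norm_num)
    exact_mod_cast Int.natAbs_ne_zero.mpr (NumberField.discr_ne_zero K)
  set Y : ℂ_[3] := X * (((ι'.symm κc : PadicAlgCl 3)) : ℂ_[3]) with hYdef
  have hY0 : Y ≠ 0 := by
    refine mul_ne_zero hX ?_
    rw [PadicComplex.coe_eq]
    exact (map_ne_zero_iff _ (algebraMap (PadicAlgCl 3) ℂ_[3]).injective).mpr ((map_ne_zero_iff _ ι'.symm.injective).mpr hκc0)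
  refine ⟨ΩK', C, X, Y, L₂, hΩK', hC, hX, hY0, hL₂, ?_⟩
  intro c hc τ hτ A hA
  haveI : IsGalois ℚ K := Literature.FieldTheory.Galois.isGalois_of_finrank_eq_two hK.1
  -- the non-trivial element `g = c̄` of `Gal(K/ℚ)` and the swap of the two places above `3`
  set g := absGaloisQuot ℚ K c with hgdef
  have hg𝔭 : g • 𝔭 = 𝔭' := V83Jacquet.absGaloisQuot_smul_eq hK hc h3 h3' hne
  have hg𝔭' : g • 𝔭' = 𝔭 := V83Jacquet.absGaloisQuot_smul_eq hK hc h3' h3 (Ne.symm hne)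
  -- the fibred supply in this 𝔭-adapted frame
  -- the fibred supply in this 𝔭-adapted frame — a THEOREM (`…ThinComb.FibredSupply`), modulo the Jacquet cone fact for the continuations
  obtain ⟨ϖ, hϖ0, hϖ, D₂, hD₂, hD₂ϖ, hfib⟩ :=
    FibredSupply.fibredSupply hJ (by norm_num) hK W Dt hH h3 h3' hne ι' hι hpair.out hur₁ hc hτ
  refine ReflectionTransfer.associated_frameSubst_of_toricUpTo₂_of_feRatio hpair.out τ A hA hL₂ (κ := κc) rfl hϖ0 hϖ hD₂ hD₂ϖ
    fun y hy ↦ (hfib y hy).mono fun x hx ↦ ⟨hx.1, ?_⟩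
  obtain ⟨ψ, a, b, r, L, ha, hb, hinf, hunr, hr, hrκ, hLd, hLe, hx1, hy1⟩ := hx.2
  -- the reflected partner `(ψ†, r†)`
  obtain ⟨ψ', r', hψ', hinf', hunr', hr', hrκ', hval⟩ :=
    ReflectedAvatar.exists_reflected_partner hK ι' hpair.out hc hτ hinf hunr hr hrκ
  -- Jacquet at `ψ` (continuations of `ψ`, `ψ⁻¹` and the `Λ`-functional equation) and at `ψ†` (its continuation)
  obtain ⟨L₁, L₁', hL₁, hL₁', hL₁e, hL₁'e, hFE⟩ := hJ K hK Dt.f Dt.isNewformOf.1 hH ψ a b ha hb hunr hinf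
  obtain ⟨L'', -, hL'', -, hL''e, -, -⟩ := hJ K hK Dt.f Dt.isNewformOf.1 hH ψ' b a hb ha hunr' hinf'
  -- the `Λ`-identity at `s = 1`
  have hb' : (1 : ℝ) ≤ b := by exact_mod_cast hb
  have ha' : (1 : ℝ) ≤ a := by exact_mod_cast ha
  have h1 := hFE 1 (by rw [Complex.one_re]; linarith) (by rw [Complex.one_re]; linarith)
  have e1 : (1 : ℂ) + b - 1 = b := by ring
  have e2 : (a : ℂ) + 1 - 1 = a := by ring
  have e3 : (a : ℂ) + 2 - 1 = a + 1 := by ring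
  have e4 : (2 : ℂ) + a - b - 2 * 1 = a - b := by ring
  have e5 : (2 : ℂ) - 1 = 1 := by ring
  rw [e1, e2, e3, e4, e5, add_comm (1 : ℂ) (b : ℂ)] at h1
  -- `L₁ = L` on the nose (both continue the same Euler product from `re s > a + 2`)
  have hLL : L₁ = L := DisplayFunctionalEquation.eq_of_entire_of_eqOn_halfPlane hLd hLe hL₁ hL₁e
  rw [hLL] at h1
  -- the display clause with `κ = N·|d_K|/4`
  have hL''e' : ∀ s : ℂ, (b : ℝ) + 2 < s.re → L'' s = rankinSelbergEulerProductHecke Dt.f (HeckeCharacter.galConj g ψ)⁻¹ s := by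
    intro s hs; rw [← hψ']; exact hL''e s hs
  have hdisp := DisplayFunctionalEquation.displayFE_of_lambdaFE_at_one (p := 3) Dt.f g hg𝔭 hg𝔭' hunr ΩK' hL₁' hL₁'e hL'' hL''e' h1
  rw [← hψ'] at hdisp
  exact ⟨ψ, ψ', a, b, r, r', L, L'', ha, hb, hinf, hunr, hr, hrκ, hLd, hLe, hinf', hunr', hr', hrκ', hL'', hL''e, hval γ₁, hval γ₂,
    hdisp, hx1, hy1⟩

/-- **THE CRUX BY NAME from (N), Jacquet's cone fact, Nekovář's fact and `stub_ratCombDvdUpTo2`** — the fibred supply discharged; through the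
v8.1 certificate `RationalSplitIMCInclusionAtThree_of_toricExistsSymm_of_nekovar_of_ratCombDvd`. [cite: Jacquet1972, §19 Thm. 19.14, Cor. 19.15]
[cite: Nekovar2006, Thm. 8.9.9, Prop. 9.6.6 (ii)] [cite: Gu2025FiniteSlopeUniversalRS, Conj. 2.15 (arXiv:2512.01184)] [cite: Hida1988AIF, §5 Thm. 5.1b] -/
theorem RationalSplitIMCInclusionAtThree_of_normalisedToric_of_jacquet_of_nekovar_of_ratCombDvd
    (hN :
        ∀ (W : WeierstrassCurve ℚ) [W.IsElliptic] [W.IsGloballyMinimal] (N : ℕ) [NeZero N] (K : Type) [Field K]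
          [NumberField K] (Dt : Literature.NumberTheory.EllipticCurves.ModularForms.ModularParametrizationData W N),
        Summit.BirchSwinnertonDyer.Rank1Residual.Additive.ClassO6 W 3 → W.HasSurjectiveModNGaloisRep 3 →
        W.analyticRank = 1 → W.conductorNorm ℤ = N → IsImaginaryQuadratic K → SatisfiesHeegnerHypothesis N K →
        ∀ (κ' : ZpExtension K 3), κ'.IsAnticyclotomic → ∀ (γ : Field.absoluteGaloisGroup K) [Fact (κ'.IsTopGenerator γ)]
          (𝔭 : HeightOneSpectrum (𝓞 K)), ((3 : ℕ) : 𝓞 K) ∈ 𝔭.asIdeal →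
          𝔭.asIdeal.ramificationIdx (𝓞 ℚ) = 1 → 𝔭.asIdeal.inertiaDeg (𝓞 ℚ) = 1 →
        ∀ (𝔭' : HeightOneSpectrum (𝓞 K)), ((3 : ℕ) : 𝓞 K) ∈ 𝔭'.asIdeal → 𝔭' ≠ 𝔭 →
        ∀ (ι' : PadicAlgCl 3 ≃+* ℂ), Summit.BirchSwinnertonDyer.BirchSwinnertonDyer.Theorems.SchneiderFree.BranchInducesPrime 3 ι' 𝔭 →
        ∀ (κ₁ κ₂ : ZpExtension K 3) (γ₁ γ₂ : Field.absoluteGaloisGroup K) (k : ℕ)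
          [Fact (ZpExtension.IsTopGeneratorPair κ₁ κ₂ γ₁ γ₂)],
        (∀ v : HeightOneSpectrum (𝓞 K), v ≠ 𝔭 → ∀ 𝔓 ∈ v.primesAbove,
            𝔓.inertia (Field.absoluteGaloisGroup K) ≤ κ₁.kerSubgroup) →
        ZpExtension.pairKer κ₁ κ₂ ≤ κ'.kerSubgroup → γ₁ * γ⁻¹ ∈ κ'.kerSubgroup → γ₂ * (γ ^ (3 ^ k))⁻¹ ∈ κ'.kerSubgroup →
        ∃ (ΩK' : ℂ) (C X : ℂ_[3]) (L₂ : PowerSeries (PowerSeries (unrIntegers 3))),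
          ΩK' ≠ 0 ∧ C ≠ 0 ∧ X ≠ 0 ∧
          IsToricTwoVarLFunctionUpTo₂ C X
            (X * (((ι'.symm ((N : ℂ) * ((NumberField.discr K).natAbs : ℂ) / 4) : PadicAlgCl 3)) : ℂ_[3]))
            ι' 𝔭 𝔭' κ₁ κ₂ γ₁ γ₂ Dt.f ΩK' L₂)
    (hJ : Literature.NumberTheory.EllipticCurves.jacquet1972_functionalEquation_rankinSelbergHecke_cone)
    (hNek : Literature.NumberTheory.EllipticCurves.nekovar2006_xGr₂_isTorsion_iff_and_charIdeal_eq_map_inv)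
    (hK2 :
        ∀ (W : WeierstrassCurve ℚ) [W.IsElliptic] [W.IsGloballyMinimal] (N : ℕ) [NeZero N] (K : Type) [Field K]
          [NumberField K] (Dt : Literature.NumberTheory.EllipticCurves.ModularForms.ModularParametrizationData W N),
        Summit.BirchSwinnertonDyer.Rank1Residual.Additive.ClassO6 W 3 → W.HasSurjectiveModNGaloisRep 3 →
        W.analyticRank = 1 → W.conductorNorm ℤ = N → IsImaginaryQuadratic K → SatisfiesHeegnerHypothesis N K →
        ∀ (𝔭 : HeightOneSpectrum (𝓞 K)), ((3 : ℕ) : 𝓞 K) ∈ 𝔭.asIdeal →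
          𝔭.asIdeal.ramificationIdx (𝓞 ℚ) = 1 → 𝔭.asIdeal.inertiaDeg (𝓞 ℚ) = 1 →
        ∀ (𝔭' : HeightOneSpectrum (𝓞 K)), ((3 : ℕ) : 𝓞 K) ∈ 𝔭'.asIdeal → 𝔭' ≠ 𝔭 →
        ∀ (ι' : PadicAlgCl 3 ≃+* ℂ), Summit.BirchSwinnertonDyer.BirchSwinnertonDyer.Theorems.SchneiderFree.BranchInducesPrime 3 ι' 𝔭 →
        ∀ (κ₁ κ₂ : ZpExtension K 3) (γ₁ γ₂ : Field.absoluteGaloisGroup K)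
          [Fact (ZpExtension.IsTopGeneratorPair κ₁ κ₂ γ₁ γ₂)],
        (∀ v : HeightOneSpectrum (𝓞 K), v ≠ 𝔭 → ∀ 𝔓 ∈ v.primesAbove,
            𝔓.inertia (Field.absoluteGaloisGroup K) ≤ κ₁.kerSubgroup) →
        Module.Finite (IwasawaAlgebra₂ 3) ((W.baseChange K).XGr₂ 3 κ₁ κ₂ 𝔭' γ₁ γ₂) →
        Module.IsTorsion (IwasawaAlgebra₂ 3) ((W.baseChange K).XGr₂ 3 κ₁ κ₂ 𝔭' γ₁ γ₂) →
        ∀ (g : IwasawaAlgebra₂ 3),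
          Literature.NumberTheory.EllipticCurves.Module.charIdeal (IwasawaAlgebra₂ 3)
            ((W.baseChange K).XGr₂ 3 κ₁ κ₂ 𝔭' γ₁ γ₂) = Ideal.span {g} →
        ∀ (ΩK' : ℂ) (C X Y : ℂ_[3]) (L₂ : PowerSeries (PowerSeries (unrIntegers 3))), ΩK' ≠ 0 → C ≠ 0 → X ≠ 0 → Y ≠ 0 →
          IsToricTwoVarLFunctionUpTo₂ C X Y ι' 𝔭 𝔭' κ₁ κ₂ γ₁ γ₂ Dt.f ΩK' L₂ →
        ThinCombDvdRat (unrIntegers 3) 3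
          (PowerSeries.map (PowerSeries.map (Summit.BirchSwinnertonDyer.Rank1Residual.X11b.Halves.toUnr 3)) g) L₂) :
    Summit.BirchSwinnertonDyer.BirchSwinnertonDyer.Theses.UniversalToricDescent.RationalSplitIMCInclusionAtThree :=
  RationalSplitIMCInclusionAtThree_of_toricExistsSymm_of_nekovar_of_ratCombDvd
    (toricExistsSymmUpTo2_of_normalised_of_jacquet hN hJ) hNek hK2

end Summit.BirchSwinnertonDyer.BirchSwinnertonDyer.Theorems.UniversalToricDescentRatwallThinCombLine.V84

end
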